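/-
Copyright: H21 programme, solo seat `solo-RiemannHypothesis-informed` (session 5).
-/
import Summits.RiemannHypothesis.RiemannHypothesis.Theorems.SoloInformedClusterWindow
import Summits.RiemannHypothesis.RiemannHypothesis.Theorems.SoloInformedFarZeros

/-!
# Maximal-offset zeros are visible up to a near cluster (solo-informed, T28)

T25 (`weilGroundEnergy_neg_of_local_cluster_eff`) sees an off-line zero `ρ₀ = ½ + η + iγ₀`
provided EVERY off-line zero of the polylog height window `|Im ρ − γ₀| < R` (`R² ≥ e^{c+1}`) is
`ρ₀`, `ρ₁ = 1 − ρ̄₀`, or a member of a dodged cluster `S'` of bounded size.  T28 removes all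
positional information about the zeros of the window that are FAR from `γ₀` in height
(`|Im ρ − γ₀| ≥ Δ₀`), asking only that none of them has a LARGER offset than `ρ₀`
(`|Re ρ − ½| ≤ η`): their sampled terms are bounded by T28a (`sum_offline_far_le`) at the cost of
the factor `1 + e^{2η(c+1)}/Δ₀²` on the cluster constant.  In particular, if `ρ₀` has maximal
offset among the zeros of its polylog window, only the NEAR zone `|Im ρ − γ₀| < Δ₀` needs the
cluster hypothesis; with `Δ₀ = e^{η(c+1)} ≍ C(η) (log γ₀)^{1/2}` (T29,
`SoloInformedClusterFarWindow`) the surcharge is the absolute factor `2`.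

The typed wall of the local Weil energy is thereby sharpened to: *micro-clusters of off-line zeros
within height distance `≍ (log γ₀)^{1/2}` of a zero of maximal offset*.
-/

open MeasureTheory Complex Set Filter Topology Literature.NumberTheory.LFunctions
open scoped ContDiff

namespace Summit.RiemannHypothesis.RiemannHypothesis.Theorems

/-! ## The far set and the cluster test -/

/-- The zeros of `ζ` with `|Re ρ − ½| ≤ η < ½`, `|Im ρ − γ₀| ≥ Δ₀` and `|Im ρ − γ₀| < R` form a
finite set. -/
theorem exists_far_finset (η γ₀ R Δ₀ : ℝ) (hη2 : η < 1 / 2) :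
    ∃ Sf : Finset ℂ, (∀ ρ ∈ Sf, riemannZeta ρ = 0 ∧ |ρ.re - 1 / 2| ≤ η ∧ Δ₀ ≤ |ρ.im - γ₀|) ∧
      (∀ ρ : ℂ, riemannZeta ρ = 0 → |ρ.re - 1 / 2| ≤ η → Δ₀ ≤ |ρ.im - γ₀| →
        |ρ.im - γ₀| < R → ρ ∈ Sf) := by
  classical
  set Zf : Set ℂ := {ρ | riemannZeta ρ = 0 ∧ |ρ.re - 1 / 2| ≤ η ∧ Δ₀ ≤ |ρ.im - γ₀| ∧
    |ρ.im - γ₀| < R} with hZf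
  have hZsub : Zf ⊆ weilZeroIndex (|γ₀| + R) := by
    intro ρ hρ
    rw [hZf, Set.mem_setOf_eq] at hρ
    obtain ⟨hz, hre, -, hR'⟩ := hρ
    have h0 : 0 < ρ.re := by have := (abs_le.mp hre).1; linarith
    have h1 : ρ.re < 1 := by have := (abs_le.mp hre).2; linarith
    refine ⟨hz, h0.le, h1.le, im_ne_zero_of_riemannZeta_eq_zero hz h0 h1, ?_⟩
    have := abs_sub_abs_le_abs_sub ρ.im γ₀
    linarith
  have hZfin : Zf.Finite := (weilZeroIndex_finite _).subset hZsub
  refine ⟨hZfin.toFinset, fun ρ hρ ↦ ?_, fun ρ hz hoff hfar hnear ↦ ?_⟩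
  · have h := (Set.Finite.mem_toFinset hZfin).mp hρ
    rw [hZf, Set.mem_setOf_eq] at h
    exact ⟨h.1, h.2.1, h.2.2.1⟩
  · refine (Set.Finite.mem_toFinset hZfin).mpr ?_
    rw [hZf, Set.mem_setOf_eq]
    exact ⟨hz, hoff, hfar, hnear⟩

variable {ψ : ℝ → ℝ}

/-- **The cluster test** (the construction inside T25, packaged).  For `ψ ≥ 0` smooth on
`[−1, 1]`, `0 < η`, `c ≥ 0`, `0 < δ ≤ 1`, a cluster `S'` (`|S'| ≤ N`, radius `R₀` around
`½ + iγ₀`, distance `≥ δ` from `ρ₀ = ½ + η + iγ₀` and `ρ₁ = ½ − η + iγ₀`) and a positive dipole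
gain `g = e^{ηc}Φ(η) − Φ(−η)`, the test `k = D_0 D_{S'} h_c` is an odd Weil test on `[−(c+1), c+1]`
with `‖k‖₂ > 0`, `‖k^{(j)}‖₁ ≤ 2(1 + R₀²)^N B_{2N+4}(ψ)` (`j ≤ 2`), gain
`|∫ k e^{ηt}|² ≥ η⁴ δ^{4N} g²`, and twisted transform vanishing on `S'`. -/
theorem exists_clusterTest (hψ : ContDiff ℝ ∞ ψ) (hsupp : tsupport ψ ⊆ Icc (-1) 1)
    (hψ0 : ∀ s, 0 ≤ ψ s) (N : ℕ) (R₀ : ℝ) {η γ₀ c δ : ℝ} {S' : Finset ℂ} (hη : 0 < η)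
    (hc : 0 ≤ c) (hδ : 0 < δ) (hδ1 : δ ≤ 1) (hcard : S'.card ≤ N)
    (hclus : ∀ ρ ∈ S', ‖ρ - (1 / 2 + γ₀ * I)‖ ≤ R₀ ∧ δ ≤ ‖ρ - (1 / 2 + η + γ₀ * I)‖ ∧
      δ ≤ ‖ρ - (1 / 2 - η + γ₀ * I)‖)
    (hgpos : 0 < Real.exp (η * c) * bumpLaplace ψ η - bumpLaplace ψ (-η)) :
    ∃ k : ℝ → ℂ, IsWeilTest k ∧ (∀ t, k (-t) = -k t) ∧ tsupport k ⊆ Icc (-(c + 1)) (c + 1) ∧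
      0 < ∫ t, ‖k t‖ ^ 2 ∧
      (∀ j ≤ 2, ∫ t, ‖iteratedDeriv j k t‖ ≤ 2 * ((1 + R₀ ^ 2) ^ N * bumpNormSum ψ (2 * N + 4))) ∧
      η ^ 4 * δ ^ (4 * N) * (Real.exp (η * c) * bumpLaplace ψ η - bumpLaplace ψ (-η)) ^ 2 ≤
        ‖∫ t, k t * cexp ((η : ℂ) * t)‖ ^ 2 ∧
      (∀ ρ ∈ S', weilMellin (fun t ↦ k t * cexp (-(γ₀ * I) * t)) ρ = 0) := by
  set B : ℝ := bumpNormSum ψ (2 * N + 4) with hB_def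
  have hB0 : 0 ≤ B := bumpNormSum_nonneg ψ _
  set Q : ℝ := (1 + R₀ ^ 2) ^ N * B with hQ_def
  -- the test `k = D_0 D_{clusterList} h_c`
  set L : List ℂ := clusterList γ₀ S' with hL_def
  set w : ℝ → ℂ := weilDodges L (bumpDipole ψ c) with hw_def
  set k : ℝ → ℂ := weilDodge 0 w with hk_def
  have hh : IsWeilTest (bumpDipole ψ c) := isWeilTest_bumpDipole hψ hsupp hc
  have hhodd : ∀ t, bumpDipole ψ c (-t) = -bumpDipole ψ c t := bumpDipole_odd ψ c
  have hhs : tsupport (bumpDipole ψ c) ⊆ Icc (-(c + 1)) (c + 1) :=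
    tsupport_bumpDipole_subset hsupp hc
  have hw : IsWeilTest w := isWeilTest_weilDodges hh L
  have hwodd : ∀ t, w (-t) = -w t := weilDodges_odd hhodd L
  have hk : IsWeilTest k := isWeilTest_weilDodge hw 0
  have hkodd : ∀ t, k (-t) = -k t := weilDodge_odd hwodd 0
  have hks : tsupport k ⊆ Icc (-(c + 1)) (c + 1) :=
    ((tsupport_weilDodge_subset 0 w).trans (tsupport_weilDodges_subset L _)).trans hhs
  have hk_eq : k = weilDodges (0 :: L) (bumpDipole ψ c) := rfl
  -- the gain of the undodged dipole
  set g : ℝ := Real.exp (η * c) * bumpLaplace ψ η - bumpLaplace ψ (-η) with hg_def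
  have hg0 : 0 ≤ g := hgpos.le
  have hgain : g ≤ ‖∫ t, bumpDipole ψ c t * cexp ((η : ℂ) * t)‖ :=
    gain_bumpDipole hψ.continuous hsupp hψ0 hη.le hc
  have hint_ne : ∫ t, bumpDipole ψ c t * cexp ((η : ℂ) * t) ≠ 0 := by
    intro h0
    rw [h0, norm_zero] at hgain
    linarith
  -- the cluster symbol at the pair
  set Pη : ℂ := ∏ ρ ∈ S', (ρ - (1 / 2 + η + γ₀ * I)) * (ρ - (1 / 2 - η + γ₀ * I)) with hPη_def
  have hPη : δ ^ (2 * S'.card) ≤ ‖Pη‖ :=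
    pow_le_norm_clusterSymbol S' hδ.le fun ρ hρ ↦ ⟨(hclus ρ hρ).2.1, (hclus ρ hρ).2.2⟩
  have hPηN : δ ^ (2 * N) ≤ ‖Pη‖ := (pow_le_pow_of_le_one hδ.le hδ1 (by omega)).trans hPη
  have hPη0 : 0 < ‖Pη‖ := lt_of_lt_of_le (by positivity) hPηN
  have e1 : ∀ f : ℝ → ℂ, ∫ t : ℝ, f t * cexp ((η : ℂ) * t) = weilMellin f (1 / 2 + η) := by
    intro f; unfold weilMellin; congr 1 with t; congr 2; ring
  have hsymb : (L.map fun τ ↦ (-((1 : ℂ) / 2 + η - 1 / 2) ^ 2 - τ ^ 2)).prod = Pη := by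
    rw [hPη_def, ← clusterSymbol_eq γ₀ S' η, hL_def]
    have e : (fun τ : ℂ ↦ (-((1 : ℂ) / 2 + η - 1 / 2) ^ 2 - τ ^ 2)) =
        fun τ ↦ (-(η : ℂ) ^ 2 - τ ^ 2) := by
      funext τ; ring
    rw [e]
  have hw_int : ∫ t, w t * cexp ((η : ℂ) * t) =
      Pη * ∫ t, bumpDipole ψ c t * cexp ((η : ℂ) * t) := by
    rw [e1, e1, hw_def, weilMellin_weilDodges hh L, hsymb]
  have hw_ne : ∫ t, w t * cexp ((η : ℂ) * t) ≠ 0 := by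
    rw [hw_int]; exact mul_ne_zero (norm_pos_iff.mp hPη0) hint_ne
  have hpos : 0 < ∫ t, ‖k t‖ ^ 2 := integral_norm_sq_weilDodge_zero_pos hw hη.ne' hw_ne
  have hnη : ‖(-((1 : ℂ) / 2 + η - 1 / 2) ^ 2 - (0 : ℂ) ^ 2)‖ = η ^ 2 := by
    have e : (-((1 : ℂ) / 2 + η - 1 / 2) ^ 2 - (0 : ℂ) ^ 2) = (((-(η ^ 2)) : ℝ) : ℂ) := by
      push_cast; ring
    rw [e, Complex.norm_real, Real.norm_eq_abs, abs_neg, abs_of_nonneg (sq_nonneg η)]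
  have hk_int : ‖∫ t, k t * cexp ((η : ℂ) * t)‖ ^ 2 =
      η ^ 4 * ‖Pη‖ ^ 2 * ‖∫ t, bumpDipole ψ c t * cexp ((η : ℂ) * t)‖ ^ 2 := by
    rw [e1 k, hk_def, weilMellin_weilDodge (contDiff_two_of_isWeilTest hw) hw.2, ← e1 w, hw_int,
      norm_mul, norm_mul, hnη]
    ring
  -- the list `0 :: L`: length and norm-inflation factor
  have hlen : (0 :: L).length = S'.card + 1 := by
    rw [List.length_cons, hL_def, length_clusterList]
  have hprod : ((0 :: L).map fun τ ↦ 1 + ‖τ‖ ^ 2).prod ≤ (1 + R₀ ^ 2) ^ N := by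
    rw [List.map_cons, List.prod_cons, norm_zero, hL_def]
    unfold clusterList
    rw [List.map_map, Finset.prod_map_toList]
    have e : ∏ ρ ∈ S', ((fun τ : ℂ ↦ 1 + ‖τ‖ ^ 2) ∘ clusterShift γ₀) ρ =
        ∏ ρ ∈ S', (1 + ‖ρ - (1 / 2 + γ₀ * I)‖ ^ 2) := by
      refine Finset.prod_congr rfl fun ρ _ ↦ ?_
      simp only [Function.comp_apply, clusterShift, norm_mul, Complex.norm_I, one_mul]
      rw [show ρ - 1 / 2 - (γ₀ : ℂ) * I = ρ - (1 / 2 + γ₀ * I) by ring]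
    rw [e]
    calc ((1 : ℝ) + 0 ^ 2) * ∏ ρ ∈ S', (1 + ‖ρ - (1 / 2 + γ₀ * I)‖ ^ 2)
        = ∏ ρ ∈ S', (1 + ‖ρ - (1 / 2 + γ₀ * I)‖ ^ 2) := by ring
      _ ≤ ∏ _ρ ∈ S', (1 + R₀ ^ 2) := by
          refine Finset.prod_le_prod (fun ρ _ ↦ by positivity) fun ρ hρ ↦ ?_
          have h1 := (hclus ρ hρ).1
          nlinarith [norm_nonneg (ρ - (1 / 2 + γ₀ * I))]
      _ = (1 + R₀ ^ 2) ^ S'.card := Finset.prod_const _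
      _ ≤ (1 + R₀ ^ 2) ^ N := pow_le_pow_right₀ (by nlinarith) hcard
  -- the `c`-independent norms of `k`
  have hnorm : ∀ j ≤ 2, ∫ t, ‖iteratedDeriv j k t‖ ≤ 2 * Q := by
    intro j hj
    have hjm : j + 2 * (0 :: L).length ≤ 2 * N + 4 := by rw [hlen]; omega
    calc ∫ t, ‖iteratedDeriv j k t‖
        = ∫ t, ‖iteratedDeriv j (weilDodges (0 :: L) (bumpDipole ψ c)) t‖ := by rw [hk_eq]
      _ ≤ ((0 :: L).map fun τ ↦ 1 + ‖τ‖ ^ 2).prod * (2 * B) :=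
          integral_norm_iteratedDeriv_weilDodges_bumpDipole_le hψ hsupp hc (2 * N + 4) (0 :: L) hjm
      _ ≤ (1 + R₀ ^ 2) ^ N * (2 * B) := mul_le_mul_of_nonneg_right hprod (by positivity)
      _ = 2 * Q := by rw [hQ_def]; ring
  -- the gain of `k` dominates `η⁴ δ^{4N} g²`
  have hG : η ^ 4 * δ ^ (4 * N) * g ^ 2 ≤ ‖∫ t, k t * cexp ((η : ℂ) * t)‖ ^ 2 := by
    rw [hk_int]
    have hP2 : δ ^ (4 * N) ≤ ‖Pη‖ ^ 2 := by
      rw [show 4 * N = 2 * N * 2 by ring, pow_mul]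
      exact pow_le_pow_left₀ (by positivity) hPηN 2
    have hG2 : g ^ 2 ≤ ‖∫ t, bumpDipole ψ c t * cexp ((η : ℂ) * t)‖ ^ 2 :=
      pow_le_pow_left₀ hg0 hgain 2
    have hPG := mul_le_mul hP2 hG2 (sq_nonneg _) (sq_nonneg _)
    calc η ^ 4 * δ ^ (4 * N) * g ^ 2 = η ^ 4 * (δ ^ (4 * N) * g ^ 2) := by ring
      _ ≤ η ^ 4 * (‖Pη‖ ^ 2 * ‖∫ t, bumpDipole ψ c t * cexp ((η : ℂ) * t)‖ ^ 2) :=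
          mul_le_mul_of_nonneg_left hPG (by positivity)
      _ = η ^ 4 * ‖Pη‖ ^ 2 * ‖∫ t, bumpDipole ψ c t * cexp ((η : ℂ) * t)‖ ^ 2 := by ring
  -- the twisted transform of `k` vanishes on the cluster
  have hvan : ∀ ρ ∈ S', weilMellin (fun t ↦ k t * cexp (-(γ₀ * I) * t)) ρ = 0 := by
    intro ρ hρ
    rw [hk_eq, weilMellin_weilDodges_twist hh, List.map_cons, List.prod_cons]
    have h0 := weilMellin_clusterDodges_twist_eq_zero hh γ₀ S' hρ
    rw [weilMellin_weilDodges_twist hh, ← hL_def] at h0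
    rw [mul_assoc, h0, mul_zero]
  exact ⟨k, hk, hkodd, hks, hpos, hnorm, hG, hvan⟩

/-! ## T28 -/

/-- **T28 (maximal-offset cluster visibility, effective).**  Let `ψ ≥ 0` be smooth with support in
`[−1, 1]`, `Φ = bumpLaplace ψ`, `0 < η < ½`, `γ₀ ≠ 0`, `c ≥ 0`, `R ≥ 1`, `e^{c+1} ≤ R²`,
`0 < δ ≤ 1`, `Δ₀ ≥ 1`, and let `ρ₀ = ½ + η + iγ₀` be a zero of `ζ`.  Suppose every off-line zero
`ρ` of `ζ` with `|Im ρ − γ₀| < R` is `ρ₀`, `ρ₁ = ½ − η + iγ₀`, a member of the finite set `S'`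
(`|S'| ≤ N`, `‖ρ − (½ + iγ₀)‖ ≤ R₀`, distance `≥ δ` from `ρ₀, ρ₁`), OR satisfies
`|Re ρ − ½| ≤ η` and `|Im ρ − γ₀| ≥ Δ₀` (far, offset not larger).  If `Φ(−η) ≤ e^{ηc} Φ(η)` and
`K_N(ψ,R₀)·(1 + e^{2η(c+1)}/Δ₀²)·log(|γ₀|+2) < η⁴ δ^{4N} (e^{ηc} Φ(η) − Φ(−η))²`, then the Weil
ground-state energy at the window `c + 1` is negative. -/
theorem weilGroundEnergy_neg_of_maxOffset_cluster_eff (hψ : ContDiff ℝ ∞ ψ)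
    (hsupp : tsupport ψ ⊆ Icc (-1) 1) (hψ0 : ∀ s, 0 ≤ ψ s) (N : ℕ) (R₀ : ℝ) :
    ∀ (η γ₀ c R δ Δ₀ : ℝ) (S' : Finset ℂ), 0 < η → η < 1 / 2 → γ₀ ≠ 0 → 0 ≤ c → 1 ≤ R →
      Real.exp (c + 1) ≤ R ^ 2 → 0 < δ → δ ≤ 1 → 1 ≤ Δ₀ →
      riemannZeta (1 / 2 + η + γ₀ * I) = 0 → S'.card ≤ N →
      (∀ ρ ∈ S', ‖ρ - (1 / 2 + γ₀ * I)‖ ≤ R₀ ∧ δ ≤ ‖ρ - (1 / 2 + η + γ₀ * I)‖ ∧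
          δ ≤ ‖ρ - (1 / 2 - η + γ₀ * I)‖) →
      (∀ ρ : ℂ, riemannZeta ρ = 0 → 0 ≤ ρ.re → ρ.re ≤ 1 → |ρ.im - γ₀| < R → ρ.re ≠ 1 / 2 →
          ρ = 1 / 2 + η + γ₀ * I ∨ ρ = 1 / 2 - η + γ₀ * I ∨ ρ ∈ S' ∨
            (|ρ.re - 1 / 2| ≤ η ∧ Δ₀ ≤ |ρ.im - γ₀|)) →
      bumpLaplace ψ (-η) ≤ Real.exp (η * c) * bumpLaplace ψ η →
      (clusterK ψ N R₀ * (1 + Real.exp (η * (c + 1)) ^ 2 / Δ₀ ^ 2) * Real.log (|γ₀| + 2) <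
          η ^ 4 * δ ^ (4 * N) *
            (Real.exp (η * c) * bumpLaplace ψ η - bumpLaplace ψ (-η)) ^ 2) →
      weilGroundEnergy (c + 1) < 0 := by
  intro η γ₀ c R δ Δ₀ S' hη hη2 hγ hc hR hRa hδ hδ1 hΔ hζ hcard hclus hloc hgainpos hwin
  unfold clusterK at hwin
  have hT := weilGroundEnergy_neg_of_local_oddTest_cluster_far
  set A₁ : ℝ := zetaDensityConst
  have hA₁ : 0 < A₁ := zetaDensityConst_pos
  set Q : ℝ := (1 + R₀ ^ 2) ^ N * bumpNormSum ψ (2 * N + 4) with hQ_def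
  have hQ0 : 0 ≤ Q := by have := bumpNormSum_nonneg ψ (2 * N + 4); positivity
  set X : ℝ := Real.exp (η * (c + 1)) ^ 2 / Δ₀ ^ 2 with hX_def
  have hΔ0 : 0 < Δ₀ := by linarith
  have hX0 : 0 ≤ X := by positivity
  set g : ℝ := Real.exp (η * c) * bumpLaplace ψ η - bumpLaplace ψ (-η) with hg_def
  have hlog : 0 < Real.log (|γ₀| + 2) := Real.log_pos (by linarith [abs_nonneg γ₀])
  have hXL : 0 ≤ X * Real.log (|γ₀| + 2) := mul_nonneg hX0 hlog.le
  have hAXL : 0 ≤ A₁ * Q ^ 2 * X * Real.log (|γ₀| + 2) := by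
    have := hA₁.le; positivity
  have hg0 : 0 ≤ g := sub_nonneg.mpr hgainpos
  have hgpos : 0 < g := by
    rcases hg0.lt_or_eq with h | h
    · exact h
    · exfalso
      rw [← h] at hwin
      have : 0 < (16 * A₁ * Q ^ 2 + 1) * (1 + X) * Real.log (|γ₀| + 2) := by positivity
      norm_num at hwin
      linarith
  -- the cluster test and the far set
  obtain ⟨k, hk, hkodd, hks, hpos, hnorm, hG, hvan⟩ :=
    exists_clusterTest hψ hsupp hψ0 N R₀ (γ₀ := γ₀) (S' := S') hη hc hδ hδ1 hcard hclus hgpos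
  obtain ⟨Sf, hSf_mem, hSf_all⟩ := exists_far_finset η γ₀ R Δ₀ hη2
  have hSf1 : ∀ ρ ∈ Sf, ρ ≠ 1 := by
    intro ρ hρ h1
    have hz := (hSf_mem ρ hρ).1
    rw [h1] at hz
    exact riemannZeta_one_ne_zero hz
  have hloc4 : ∀ ρ : ℂ, riemannZeta ρ = 0 → 0 ≤ ρ.re → ρ.re ≤ 1 → |ρ.im - γ₀| < R →
      ρ.re ≠ 1 / 2 → ρ = 1 / 2 + η + γ₀ * I ∨ ρ = 1 / 2 - η + γ₀ * I ∨ ρ ∈ S' ∨ ρ ∈ Sf := by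
    intro ρ hz h0 h1 hnear hre
    rcases hloc ρ hz h0 h1 hnear hre with h | h | h | ⟨hoff, hfarρ⟩
    · exact Or.inl h
    · exact Or.inr (Or.inl h)
    · exact Or.inr (Or.inr (Or.inl h))
    · exact Or.inr (Or.inr (Or.inr (hSf_all ρ hz hoff hfarρ hnear)))
  -- the on-line majorant (as in T25)
  have hk1 : ∫ t, ‖k t‖ ≤ 2 * Q := by simpa using hnorm 0 (by norm_num)
  have hk2 : ∫ t, ‖deriv k t‖ ≤ 2 * Q := by simpa using hnorm 1 (by norm_num)
  have hk3 : ∫ t, ‖iteratedDeriv 2 k t‖ ≤ 2 * Q := hnorm 2 le_rfl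
  have hMloc : ((∫ t, ‖k t‖) ^ 2 + (∫ t, ‖deriv k t‖) ^ 2)
      + 2 * Real.exp (c + 1) * (∫ t, ‖iteratedDeriv 2 k t‖) ^ 2 / R ^ (2 * 1)
        ≤ 4 * (Q ^ 2 + Q ^ 2 + 2 * Q ^ 2) :=
    local_majorant_arith (integral_nonneg fun _ ↦ norm_nonneg _)
      (integral_nonneg fun _ ↦ norm_nonneg _) (integral_nonneg fun _ ↦ norm_nonneg _) hk1 hk2 hk3
      (Real.exp_pos _) (by simpa using hRa)
  have h1 : 2 * A₁ * (((∫ t, ‖k t‖) ^ 2 + (∫ t, ‖deriv k t‖) ^ 2)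
      + 2 * Real.exp (c + 1) * (∫ t, ‖iteratedDeriv 2 k t‖) ^ 2 / R ^ (2 * 1))
        * Real.log (|γ₀| + 2)
      ≤ 2 * A₁ * (4 * (Q ^ 2 + Q ^ 2 + 2 * Q ^ 2)) * Real.log (|γ₀| + 2) :=
    mul_le_mul_of_nonneg_right (mul_le_mul_of_nonneg_left hMloc (by positivity)) hlog.le
  -- the far terms (T28a with `p = 2`, `θ = η`)
  have hF1 := sum_offline_far_le hk (by linarith : (0 : ℝ) ≤ c + 1) hks hη2 hΔ
    (p := 2) (by norm_num) Sf hSf_mem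
  have hBf : 2 * A₁ * (2 * (Real.exp (η * (c + 1)) * ∫ t, ‖iteratedDeriv 2 k t‖) ^ 2
      / Δ₀ ^ (2 * 2 - 2)) * Real.log (|γ₀| + 2) ≤ 16 * (A₁ * Q ^ 2 * X * Real.log (|γ₀| + 2)) := by
    have h22 : Δ₀ ^ (2 * 2 - 2) = Δ₀ ^ 2 := by norm_num
    rw [h22]
    have hEN : (Real.exp (η * (c + 1)) * ∫ t, ‖iteratedDeriv 2 k t‖) ^ 2 ≤
        (Real.exp (η * (c + 1)) * (2 * Q)) ^ 2 :=
      pow_le_pow_left₀ (by positivity) (mul_le_mul_of_nonneg_left hk3 (Real.exp_pos _).le) 2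
    have h3 : 2 * (Real.exp (η * (c + 1)) * ∫ t, ‖iteratedDeriv 2 k t‖) ^ 2 / Δ₀ ^ 2 ≤
        2 * (Real.exp (η * (c + 1)) * (2 * Q)) ^ 2 / Δ₀ ^ 2 :=
      div_le_div_of_nonneg_right (by linarith) (by positivity)
    have h4 := mul_le_mul_of_nonneg_right (mul_le_mul_of_nonneg_left h3
      (by positivity : (0 : ℝ) ≤ 2 * A₁)) hlog.le
    refine h4.trans_eq ?_
    rw [hX_def]
    ring
  -- the zero has multiplicity `≥ 1`
  have hne1 : (1 / 2 + η + γ₀ * I : ℂ) ≠ 1 := by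
    intro h
    apply hγ
    have := congrArg Complex.im h
    simpa using this
  have hm1 : (1 : ℝ) ≤ (riemannZetaZeroOrder (1 / 2 + η + γ₀ * I) : ℝ) := by
    have := (riemannZetaZeroOrder_pos_iff hne1).mpr hζ
    have h1m : (1 : ℤ) ≤ riemannZetaZeroOrder (1 / 2 + η + γ₀ * I) := by omega
    exact_mod_cast h1m
  have hmP := mul_le_mul_of_nonneg_right hm1 (sq_nonneg ‖∫ t, k t * cexp ((η : ℂ) * t)‖)
  have h2 : 2 * A₁ * (4 * (Q ^ 2 + Q ^ 2 + 2 * Q ^ 2)) * Real.log (|γ₀| + 2)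
      + 2 * A₁ * (2 * (Real.exp (η * (c + 1)) * ∫ t, ‖iteratedDeriv 2 k t‖) ^ 2
          / Δ₀ ^ (2 * 2 - 2)) * Real.log (|γ₀| + 2) <
      2 * ((riemannZetaZeroOrder (1 / 2 + η + γ₀ * I) : ℝ)
        * ‖∫ t, k t * cexp ((η : ℂ) * t)‖ ^ 2) := by
    linarith [hwin, hG, hmP, hlog, hBf, hXL, hAXL]
  have key := hT k (c + 1) η γ₀ R _ 1 S' Sf hk hkodd (by linarith) hR hks hpos hζ
    (abs_lt.mpr ⟨by linarith, hη2⟩) hη.ne' hγ hvan hSf1 hF1 hloc4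
  exact key (by linarith [h1, h2])

end Summit.RiemannHypothesis.RiemannHypothesis.Theorems
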